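import Summits.HodgeConjecture.CorCM.IrreducibleOddWeightsCommutantCentreDegree
import Summits.HodgeConjecture.CorCM.IrreducibleOddWeightsCommutantAbelian
import Summits.HodgeConjecture.CorCM.IrreducibleOddWeightsSubfamilyDominationCMFields
import Summits.HodgeConjecture.CorCM.IrreducibleOddWeightsHodgeEquivalence
import HarnessLib

/-!
# Density over the commutant, XVII: THE CENTRE ON A FINITE `G`-SET — `dim Z|_A ∣ δ` for an irreducible constituent
# `A ≤ ℚ^Y`; for a COMMUTING action the commutant is `ℚ[G]|_A`, commutative, of degree `δ = dim A`, and then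
# `dim S(w) = dim D⟨b⟩`, `rank Φ = dim D⟨b⟩ + 1`, `rank Σ = dim(⨆_i D⟨b^i⟩) + 1`

COR-CM (cell `pub-hodgecm2`, binder seat `b16` gen 74, count-neutral claim THE CENTRE, file Z4 — `G`-set dress of
files Z1–Z3 (operators `T_k f = f(k·)` on `ℚ^Y`, the image of `ℚ[G]`), type ranks and CM dress; theorems only, no
definition, no named fact, no `sorry`).  NEW as stated, hence under `Summits/`.  HONEST FRAMING: the lane's CM currency — a finite
`G`-set `Y` (`Aut(ℂ)` on `Hom(L, ℂ)`), a `G`-stable IRREDUCIBLE `A ≤ ℚ^Y` (an irreducible odd constituent; up to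
isogeny a simple CM factor's `H¹`-piece) with commutant `𝒟` (gen 72 C1, ANY), bicommutant `ℬ` (gen 73 K2); the image
of the group algebra is `span{T_k} = span{f ↦ f(k·)}`.  Nothing about Hodge classes is asserted; `HC_CM` is neither
used nor asserted.

* §1 `centre_restrict_eq_inf_span_translates` (`(𝒟 ⊓ ℬ)|_A = 𝒟|_A ⊓ ℚ[G]|_A`), **`finrank_centre_restrict_dvd_translates`:
  `dim Z|_A ∣ δ`**, `finrank_centre_restrict_dvd_finrank_translates` (`dim Z|_A ∣ dim A`),
  `commutant_restrict_le_span_translates_iff_comm` (`𝒟|_A ≤ ℚ[G]|_A ⟺ 𝒟` commutative on `A`).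
* §2 COMMUTING ACTION (`k·k′·y = k′·k·y` on `Y`, e.g. `G` abelian, or `Aut(ℂ)` acting on the embeddings of an
  ABELIAN CM field): **`finrank_map_applyₗ_eq_finrank_of_comm_translates`: `δ = dim A`**,
  **`commutant_restrict_eq_span_translates_of_comm`: `𝒟|_A = ℚ[G]|_A`**, `commutant_apply_comm_of_comm_translates`
  (the commutant is commutative), `map_applyₗ_eq_of_comm_translates` (`D·a₀ = A`).
* §3 RANKS FOR A COMMUTING ACTION (`δ = dim A` collapses every `·δ`/`·dim A` count of gen 72 C4, files S2/S4):
  **`finrank_span_shadowCoeff_sum_eq_finrank_iSup_of_comm`: `dim S(Σ_j ι_j b_j) = dim D⟨b⟩`**,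
  **`typeRank_eq_finrank_iSup_add_one_of_comm`: `rank Φ = dim D⟨b⟩ + 1`**,
  **`typeRank_sigmaType_eq_finrank_iSup_add_one_of_comm`: `rank Σ = dim(⨆_i D⟨b^i⟩) + 1`** (a whole family in one
  isotypic class); CM dress `cmTypeRank_eq_finrank_iSup_add_one_of_comm`, `cmFamilyRank_eq_finrank_iSup_add_one_of_comm`
  (`dim MT(∏ A_i) − 1 = dim_ℚ ⨆_i D⟨b^i⟩` when `Aut(ℂ)` acts through commuting permutations of the reference set).

## References

* [CurtisReiner1962] C. W. Curtis, I. Reiner, *Representation Theory of Finite Groups and Associative Algebras*,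
  §27 (27.3), §59, §68.
* [Serre1977] J.-P. Serre, *Linear Representations of Finite Groups*, GTM 42, §3.1, §12.1.
* [Lang2002] S. Lang, *Algebra*, 3rd ed., XVII §1 Prop. 1.1, XVII §3.
* [Deligne1982HodgeCycles] P. Deligne, *Hodge cycles on abelian varieties*, LNM 900 (1982), I.3.4, I Ex. 3.7.
-/

set_option autoImplicit false

noncomputable section

open scoped BigOperators Classical

universe u u₀ v v₀ vE w

namespace Summit.HodgeConjecture.CorCM.IrrOdd

variable {G : Type w} [Group G] {Y : Type v} [MulAction G Y] [Fintype Y]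

omit [Fintype Y] in
/-- The translation operators `T_k f = f(k·)` contain the identity. [folklore] -/
theorem exists_translate_eq_id :
    ∃ k₀ : G, (fun k : G => LinearMap.funLeft ℚ ℚ (fun y : Y => k • y)) k₀ = LinearMap.id :=
  ⟨1, LinearMap.ext fun f => funext fun y => by simp [LinearMap.funLeft_apply]⟩

omit [Fintype Y] in
/-- The translation operators are closed under composition (`T_{k′k} = T_k ∘ T_{k′}`). [folklore] -/
theorem exists_translate_eq_comp (k k' : G) :
    ∃ k'' : G, (fun k : G => LinearMap.funLeft ℚ ℚ (fun y : Y => k • y)) k'' =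
      (fun k : G => LinearMap.funLeft ℚ ℚ (fun y : Y => k • y)) k ∘ₗ
        (fun k : G => LinearMap.funLeft ℚ ℚ (fun y : Y => k • y)) k' :=
  ⟨k' * k, LinearMap.ext fun f => funext fun y => by simp [LinearMap.funLeft_apply, mul_smul]⟩

/-! ### §1 The centre of the commutant of an irreducible constituent of `ℚ^Y` -/

/-- **`(𝒟 ⊓ ℬ)|_A = 𝒟|_A ⊓ ℚ[G]|_A`**: the centre restricted to the irreducible constituent `A` is the intersection of
the commutant with the image of the group algebra (file Z1). [cite: CurtisReiner1962, §59] -/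
theorem centre_restrict_eq_inf_span_translates {A : Submodule ℚ (Y → ℚ)} {𝒟 ℬ : Submodule ℚ ((Y → ℚ) →ₗ[ℚ] (Y → ℚ))}
    (h𝒟 : ∀ L : (Y → ℚ) →ₗ[ℚ] (Y → ℚ), L ∈ 𝒟 ↔ (∀ a ∈ A, L a ∈ A) ∧
      ∀ (k : G) (a : Y → ℚ), a ∈ A → L (fun y => a (k • y)) = fun y => L a (k • y))
    (hℬ : ∀ ψ : (Y → ℚ) →ₗ[ℚ] (Y → ℚ), ψ ∈ ℬ ↔ (∀ a ∈ A, ψ a ∈ A) ∧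
      ∀ (L : ↥𝒟) (a : Y → ℚ), a ∈ A → ψ ((L : (Y → ℚ) →ₗ[ℚ] (Y → ℚ)) a) = (L : (Y → ℚ) →ₗ[ℚ] (Y → ℚ)) (ψ a))
    (hAst : ∀ (k : G) (a : Y → ℚ), a ∈ A → (fun y => a (k • y)) ∈ A)
    (hAirr : ∀ W : Submodule ℚ (Y → ℚ), W ≤ A → W ≠ ⊥ →
      (∀ (k : G) (f : Y → ℚ), f ∈ W → (fun y => f (k • y)) ∈ W) → W = A) :
    (𝒟 ⊓ ℬ).map (LinearMap.domRestrict' A) =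
      𝒟.map (LinearMap.domRestrict' A) ⊓
        (Submodule.span ℚ (Set.range fun k : G => LinearMap.funLeft ℚ ℚ (fun y : Y => k • y))).map
          (LinearMap.domRestrict' A) := by
  haveI : FiniteDimensional ℚ A := Submodule.finiteDimensional_of_le le_top
  exact map_domRestrict'_centre_eq_inf_span (fun k : G => LinearMap.funLeft ℚ ℚ (fun y : Y => k • y))
    (fun L => h𝒟 L) hℬ exists_translate_eq_id exists_translate_eq_comp (fun k a ha => hAst k a ha)
    (fun W hW hW0 hWst => hAirr W hW hW0 fun k f hf => hWst k f hf)

/-- **THE DEGREE OF THE CENTRE DIVIDES `δ`: `dim (𝒟 ⊓ ℬ)|_A ∣ dim D·a₀`** for an irreducible constituent `A ≤ ℚ^Y`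
with ANY commutant (`0 ≠ a₀ ∈ A`; file Z2). [cite: CurtisReiner1962, §68] [cite: Lang2002, XVII §1] -/
theorem finrank_centre_restrict_dvd_translates {A : Submodule ℚ (Y → ℚ)} {𝒟 ℬ : Submodule ℚ ((Y → ℚ) →ₗ[ℚ] (Y → ℚ))}
    (h𝒟 : ∀ L : (Y → ℚ) →ₗ[ℚ] (Y → ℚ), L ∈ 𝒟 ↔ (∀ a ∈ A, L a ∈ A) ∧
      ∀ (k : G) (a : Y → ℚ), a ∈ A → L (fun y => a (k • y)) = fun y => L a (k • y))
    (hℬ : ∀ ψ : (Y → ℚ) →ₗ[ℚ] (Y → ℚ), ψ ∈ ℬ ↔ (∀ a ∈ A, ψ a ∈ A) ∧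
      ∀ (L : ↥𝒟) (a : Y → ℚ), a ∈ A → ψ ((L : (Y → ℚ) →ₗ[ℚ] (Y → ℚ)) a) = (L : (Y → ℚ) →ₗ[ℚ] (Y → ℚ)) (ψ a))
    (hAst : ∀ (k : G) (a : Y → ℚ), a ∈ A → (fun y => a (k • y)) ∈ A)
    (hAirr : ∀ W : Submodule ℚ (Y → ℚ), W ≤ A → W ≠ ⊥ →
      (∀ (k : G) (f : Y → ℚ), f ∈ W → (fun y => f (k • y)) ∈ W) → W = A)
    {a₀ : Y → ℚ} (ha₀ : a₀ ∈ A) (h0 : a₀ ≠ 0) :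
    Module.finrank ℚ ↥((𝒟 ⊓ ℬ).map (LinearMap.domRestrict' A)) ∣
      Module.finrank ℚ ↥(𝒟.map (LinearMap.applyₗ a₀)) := by
  haveI : FiniteDimensional ℚ A := Submodule.finiteDimensional_of_le le_top
  exact finrank_map_domRestrict'_centre_dvd (fun k : G => LinearMap.funLeft ℚ ℚ (fun y : Y => k • y))
    (fun L => h𝒟 L) hℬ (fun k a ha => hAst k a ha) (fun W hW hW0 hWst => hAirr W hW hW0 fun k f hf => hWst k f hf)
    ha₀ h0

/-- **`dim (𝒟 ⊓ ℬ)|_A ∣ dim A`** for an irreducible constituent `A ≤ ℚ^Y` (`0 ≠ a₀ ∈ A`; file Z2).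
[cite: Lang2002, XVII §1 Prop. 1.1] -/
theorem finrank_centre_restrict_dvd_finrank_translates {A : Submodule ℚ (Y → ℚ)}
    {𝒟 ℬ : Submodule ℚ ((Y → ℚ) →ₗ[ℚ] (Y → ℚ))}
    (h𝒟 : ∀ L : (Y → ℚ) →ₗ[ℚ] (Y → ℚ), L ∈ 𝒟 ↔ (∀ a ∈ A, L a ∈ A) ∧
      ∀ (k : G) (a : Y → ℚ), a ∈ A → L (fun y => a (k • y)) = fun y => L a (k • y))
    (hℬ : ∀ ψ : (Y → ℚ) →ₗ[ℚ] (Y → ℚ), ψ ∈ ℬ ↔ (∀ a ∈ A, ψ a ∈ A) ∧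
      ∀ (L : ↥𝒟) (a : Y → ℚ), a ∈ A → ψ ((L : (Y → ℚ) →ₗ[ℚ] (Y → ℚ)) a) = (L : (Y → ℚ) →ₗ[ℚ] (Y → ℚ)) (ψ a))
    (hAst : ∀ (k : G) (a : Y → ℚ), a ∈ A → (fun y => a (k • y)) ∈ A)
    (hAirr : ∀ W : Submodule ℚ (Y → ℚ), W ≤ A → W ≠ ⊥ →
      (∀ (k : G) (f : Y → ℚ), f ∈ W → (fun y => f (k • y)) ∈ W) → W = A)
    {a₀ : Y → ℚ} (ha₀ : a₀ ∈ A) (h0 : a₀ ≠ 0) :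
    Module.finrank ℚ ↥((𝒟 ⊓ ℬ).map (LinearMap.domRestrict' A)) ∣ Module.finrank ℚ A := by
  haveI : FiniteDimensional ℚ A := Submodule.finiteDimensional_of_le le_top
  exact finrank_map_domRestrict'_centre_dvd_finrank (fun k : G => LinearMap.funLeft ℚ ℚ (fun y : Y => k • y))
    (fun L => h𝒟 L) hℬ (fun k a ha => hAst k a ha) (fun W hW hW0 hWst => hAirr W hW hW0 fun k f hf => hWst k f hf)
    ha₀ h0

/-- **`𝒟|_A ≤ ℚ[G]|_A ⟺ 𝒟` IS COMMUTATIVE ON `A`**: the commutant of an irreducible constituent lies inside the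
image of the group algebra iff it is commutative (file Z1). [cite: CurtisReiner1962, §59] [cite: Lang2002, XVII §3] -/
theorem commutant_restrict_le_span_translates_iff_comm {A : Submodule ℚ (Y → ℚ)}
    {𝒟 : Submodule ℚ ((Y → ℚ) →ₗ[ℚ] (Y → ℚ))}
    (h𝒟 : ∀ L : (Y → ℚ) →ₗ[ℚ] (Y → ℚ), L ∈ 𝒟 ↔ (∀ a ∈ A, L a ∈ A) ∧
      ∀ (k : G) (a : Y → ℚ), a ∈ A → L (fun y => a (k • y)) = fun y => L a (k • y))
    (hAst : ∀ (k : G) (a : Y → ℚ), a ∈ A → (fun y => a (k • y)) ∈ A)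
    (hAirr : ∀ W : Submodule ℚ (Y → ℚ), W ≤ A → W ≠ ⊥ →
      (∀ (k : G) (f : Y → ℚ), f ∈ W → (fun y => f (k • y)) ∈ W) → W = A) :
    𝒟.map (LinearMap.domRestrict' A) ≤
        (Submodule.span ℚ (Set.range fun k : G => LinearMap.funLeft ℚ ℚ (fun y : Y => k • y))).map
          (LinearMap.domRestrict' A) ↔
      ∀ L ∈ 𝒟, ∀ L' ∈ 𝒟, ∀ a ∈ A, L (L' a) = L' (L a) := by
  haveI : FiniteDimensional ℚ A := Submodule.finiteDimensional_of_le le_top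
  exact map_domRestrict'_commutant_le_span_iff_comm (fun k : G => LinearMap.funLeft ℚ ℚ (fun y : Y => k • y))
    (fun L => h𝒟 L) exists_translate_eq_id exists_translate_eq_comp (fun k a ha => hAst k a ha)
    (fun W hW hW0 hWst => hAirr W hW hW0 fun k f hf => hWst k f hf)

/-! ### §2 A commuting action -/

/-- **`δ = dim A` FOR A COMMUTING ACTION** (`k·k′·y = k′·k·y` on `Y`; `A ≤ ℚ^Y` an irreducible constituent,
`0 ≠ a₀ ∈ A`): the commutant is a field of degree `dim A` (file Z3). [cite: Serre1977, §3.1 and §12.1] -/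
theorem finrank_map_applyₗ_eq_finrank_of_comm_translates (hcomm : ∀ (k k' : G) (y : Y), k • k' • y = k' • k • y)
    {A : Submodule ℚ (Y → ℚ)} {𝒟 : Submodule ℚ ((Y → ℚ) →ₗ[ℚ] (Y → ℚ))}
    (h𝒟 : ∀ L : (Y → ℚ) →ₗ[ℚ] (Y → ℚ), L ∈ 𝒟 ↔ (∀ a ∈ A, L a ∈ A) ∧
      ∀ (k : G) (a : Y → ℚ), a ∈ A → L (fun y => a (k • y)) = fun y => L a (k • y))
    (hAst : ∀ (k : G) (a : Y → ℚ), a ∈ A → (fun y => a (k • y)) ∈ A)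
    (hAirr : ∀ W : Submodule ℚ (Y → ℚ), W ≤ A → W ≠ ⊥ →
      (∀ (k : G) (f : Y → ℚ), f ∈ W → (fun y => f (k • y)) ∈ W) → W = A)
    {a₀ : Y → ℚ} (ha₀ : a₀ ∈ A) (h0 : a₀ ≠ 0) :
    Module.finrank ℚ ↥(𝒟.map (LinearMap.applyₗ a₀)) = Module.finrank ℚ A := by
  haveI : FiniteDimensional ℚ A := Submodule.finiteDimensional_of_le le_top
  exact finrank_map_applyₗ_eq_finrank_of_comm (fun k : G => LinearMap.funLeft ℚ ℚ (fun y : Y => k • y))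
    (fun L => h𝒟 L) exists_translate_eq_id exists_translate_eq_comp (fun k a ha => hAst k a ha)
    (fun W hW hW0 hWst => hAirr W hW hW0 fun k f hf => hWst k f hf)
    (fun k k' a _ => funext fun y => by simp [LinearMap.funLeft_apply, hcomm k' k y]) ha₀ h0

/-- **THE COMMUTANT IS THE IMAGE OF THE GROUP ALGEBRA: `𝒟|_A = ℚ[G]|_A`** for a commuting action and an
irreducible constituent `A ≠ 0` (file Z3). [cite: Serre1977, §3.1] [cite: CurtisReiner1962, §59] -/
theorem commutant_restrict_eq_span_translates_of_comm (hcomm : ∀ (k k' : G) (y : Y), k • k' • y = k' • k • y)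
    {A : Submodule ℚ (Y → ℚ)} {𝒟 : Submodule ℚ ((Y → ℚ) →ₗ[ℚ] (Y → ℚ))}
    (h𝒟 : ∀ L : (Y → ℚ) →ₗ[ℚ] (Y → ℚ), L ∈ 𝒟 ↔ (∀ a ∈ A, L a ∈ A) ∧
      ∀ (k : G) (a : Y → ℚ), a ∈ A → L (fun y => a (k • y)) = fun y => L a (k • y))
    (hAst : ∀ (k : G) (a : Y → ℚ), a ∈ A → (fun y => a (k • y)) ∈ A)
    (hAirr : ∀ W : Submodule ℚ (Y → ℚ), W ≤ A → W ≠ ⊥ →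
      (∀ (k : G) (f : Y → ℚ), f ∈ W → (fun y => f (k • y)) ∈ W) → W = A) (hA : A ≠ ⊥) :
    𝒟.map (LinearMap.domRestrict' A) =
      (Submodule.span ℚ (Set.range fun k : G => LinearMap.funLeft ℚ ℚ (fun y : Y => k • y))).map
        (LinearMap.domRestrict' A) := by
  haveI : FiniteDimensional ℚ A := Submodule.finiteDimensional_of_le le_top
  exact map_domRestrict'_commutant_eq_span_of_comm (fun k : G => LinearMap.funLeft ℚ ℚ (fun y : Y => k • y))
    (fun L => h𝒟 L) exists_translate_eq_id exists_translate_eq_comp (fun k a ha => hAst k a ha)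
    (fun W hW hW0 hWst => hAirr W hW hW0 fun k f hf => hWst k f hf)
    (fun k k' a _ => funext fun y => by simp [LinearMap.funLeft_apply, hcomm k' k y]) hA

/-- **THE COMMUTANT OF AN IRREDUCIBLE CONSTITUENT OF A COMMUTING ACTION IS COMMUTATIVE** (file Z3).
[cite: Serre1977, §3.1] -/
theorem commutant_apply_comm_of_comm_translates (hcomm : ∀ (k k' : G) (y : Y), k • k' • y = k' • k • y)
    {A : Submodule ℚ (Y → ℚ)} {𝒟 : Submodule ℚ ((Y → ℚ) →ₗ[ℚ] (Y → ℚ))}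
    (h𝒟 : ∀ L : (Y → ℚ) →ₗ[ℚ] (Y → ℚ), L ∈ 𝒟 ↔ (∀ a ∈ A, L a ∈ A) ∧
      ∀ (k : G) (a : Y → ℚ), a ∈ A → L (fun y => a (k • y)) = fun y => L a (k • y))
    (hAst : ∀ (k : G) (a : Y → ℚ), a ∈ A → (fun y => a (k • y)) ∈ A)
    (hAirr : ∀ W : Submodule ℚ (Y → ℚ), W ≤ A → W ≠ ⊥ →
      (∀ (k : G) (f : Y → ℚ), f ∈ W → (fun y => f (k • y)) ∈ W) → W = A)
    {L L' : (Y → ℚ) →ₗ[ℚ] (Y → ℚ)} (hL : L ∈ 𝒟) (hL' : L' ∈ 𝒟) {a : Y → ℚ} (ha : a ∈ A) :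
    L (L' a) = L' (L a) := by
  haveI : FiniteDimensional ℚ A := Submodule.finiteDimensional_of_le le_top
  exact commutant_apply_comm_of_comm (fun k : G => LinearMap.funLeft ℚ ℚ (fun y : Y => k • y)) (fun L => h𝒟 L)
    exists_translate_eq_id exists_translate_eq_comp (fun k a ha => hAst k a ha)
    (fun W hW hW0 hWst => hAirr W hW hW0 fun k f hf => hWst k f hf)
    (fun k k' a _ => funext fun y => by simp [LinearMap.funLeft_apply, hcomm k' k y]) hL hL' ha

/-- **`D·a₀ = A`** for a commuting action (`0 ≠ a₀ ∈ A`): the commutant is transitive on the non-zero vectors of the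
irreducible constituent (file Z3). [cite: Serre1977, §3.1] [cite: Lang2002, XVII §1 Prop. 1.1] -/
theorem map_applyₗ_eq_of_comm_translates (hcomm : ∀ (k k' : G) (y : Y), k • k' • y = k' • k • y)
    {A : Submodule ℚ (Y → ℚ)} {𝒟 : Submodule ℚ ((Y → ℚ) →ₗ[ℚ] (Y → ℚ))}
    (h𝒟 : ∀ L : (Y → ℚ) →ₗ[ℚ] (Y → ℚ), L ∈ 𝒟 ↔ (∀ a ∈ A, L a ∈ A) ∧
      ∀ (k : G) (a : Y → ℚ), a ∈ A → L (fun y => a (k • y)) = fun y => L a (k • y))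
    (hAst : ∀ (k : G) (a : Y → ℚ), a ∈ A → (fun y => a (k • y)) ∈ A)
    (hAirr : ∀ W : Submodule ℚ (Y → ℚ), W ≤ A → W ≠ ⊥ →
      (∀ (k : G) (f : Y → ℚ), f ∈ W → (fun y => f (k • y)) ∈ W) → W = A)
    {a₀ : Y → ℚ} (ha₀ : a₀ ∈ A) (h0 : a₀ ≠ 0) :
    𝒟.map (LinearMap.applyₗ a₀) = A := by
  haveI : FiniteDimensional ℚ A := Submodule.finiteDimensional_of_le le_top
  exact map_applyₗ_eq_of_comm (fun k : G => LinearMap.funLeft ℚ ℚ (fun y : Y => k • y)) (fun L => h𝒟 L)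
    exists_translate_eq_id exists_translate_eq_comp (fun k a ha => hAst k a ha)
    (fun W hW hW0 hWst => hAirr W hW hW0 fun k f hf => hWst k f hf)
    (fun k k' a _ => funext fun y => by simp [LinearMap.funLeft_apply, hcomm k' k y]) ha₀ h0

/-! ### §3 Ranks for a commuting action -/

section Ranks

open Literature.NumberTheory.ComplexMultiplication

variable {Y₀ : Type v₀} [MulAction G Y₀] [Fintype Y₀]

/-- **`dim S(Σ_j ι_j b_j) = dim D⟨b⟩` FOR A COMMUTING ACTION ON THE REFERENCE `G`-SET** (`A ≤ ℚ^Y` irreducible with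
ANY commutant; `δ = dim A` by file Z4, in gen 72 C4's `dim S·δ = dim D⟨b⟩·dim A`). [cite: Serre1977, §3.1]
[cite: Lang2002, XVII §3] -/
theorem finrank_span_shadowCoeff_sum_eq_finrank_iSup_of_comm (hcomm : ∀ (k k' : G) (y : Y), k • k' • y = k' • k • y)
    {A : Submodule ℚ (Y → ℚ)} {𝒟 : Submodule ℚ ((Y → ℚ) →ₗ[ℚ] (Y → ℚ))}
    (h𝒟 : ∀ L : (Y → ℚ) →ₗ[ℚ] (Y → ℚ), L ∈ 𝒟 ↔ (∀ a ∈ A, L a ∈ A) ∧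
      ∀ (k : G) (a : Y → ℚ), a ∈ A → L (fun y => a (k • y)) = fun y => L a (k • y))
    (hAst : ∀ (k : G) (a : Y → ℚ), a ∈ A → (fun y => a (k • y)) ∈ A)
    (hAirr : ∀ W : Submodule ℚ (Y → ℚ), W ≤ A → W ≠ ⊥ →
      (∀ (k : G) (f : Y → ℚ), f ∈ W → (fun y => f (k • y)) ∈ W) → W = A)
    (hA0 : A ≠ ⊥) {J : Type u} [Fintype J] (ι : J → ((Y → ℚ) →ₗ[ℚ] (Y₀ → ℚ)))
    (hιeq : ∀ (j : J) (k : G) (a : Y → ℚ), a ∈ A → ι j (fun y => a (k • y)) = fun y => ι j a (k • y))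
    (hind : ∀ f : J → (Y → ℚ), (∀ j, f j ∈ A) → ∑ j, ι j (f j) = 0 → ∀ j, f j = 0)
    {b : J → (Y → ℚ)} (hb : ∀ j, b j ∈ A) :
    Module.finrank ℚ ↥(Submodule.span ℚ (Set.range fun y : Y₀ => fun g : G => (∑ j, ι j (b j)) (g • y))) =
      Module.finrank ℚ ↥(⨆ j, 𝒟.map (LinearMap.applyₗ (b j))) := by
  obtain ⟨a₀, ha₀, h0⟩ := Submodule.exists_mem_ne_zero_of_ne_bot hA0
  have h := finrank_span_shadowCoeff_sum_mul_eq h𝒟 hAst hAirr ι hιeq hind hb ha₀ h0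
  rw [finrank_map_applyₗ_eq_finrank_of_comm_translates hcomm h𝒟 hAst hAirr ha₀ h0] at h
  haveI : FiniteDimensional ℚ A := Submodule.finiteDimensional_of_le le_top
  have hA : 0 < Module.finrank ℚ A := Nat.pos_of_ne_zero fun h' => hA0 (Submodule.finrank_eq_zero.1 h')
  exact Nat.eq_of_mul_eq_mul_right hA h

variable {I : Type u₀} {E : I → Type vE} [∀ i, MulAction G (E i)] [∀ i, Fintype (E i)] [Fintype I]
  [∀ i, Nonempty (E i)]

omit [Fintype I] in
/-- **`rank Φ = dim D⟨b⟩ + 1` FOR A COMMUTING ACTION**: `dim Hg(A_Φ)` is the `ℚ`-dimension of the D-span of the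
components of the type vector `u = Σ_j ι_j(b_j)` (file S2's `rank Φ·δ = δ + dim D⟨b⟩·dim A` with `δ = dim A`).
[cite: Serre1977, §3.1] [cite: Deligne1982HodgeCycles, I.3.4] -/
theorem typeRank_eq_finrank_iSup_add_one_of_comm (hcomm : ∀ (k k' : G) (y : Y), k • k' • y = k' • k • y)
    {ρ : G} {Φ : ∀ i, Set (E i)} (h : ∀ i, IsCMTypeWith ρ (Φ i)) (i₀ : I)
    {A : Submodule ℚ (Y → ℚ)} {𝒟 : Submodule ℚ ((Y → ℚ) →ₗ[ℚ] (Y → ℚ))}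
    (h𝒟 : ∀ L : (Y → ℚ) →ₗ[ℚ] (Y → ℚ), L ∈ 𝒟 ↔ (∀ a ∈ A, L a ∈ A) ∧
      ∀ (k : G) (a : Y → ℚ), a ∈ A → L (fun y => a (k • y)) = fun y => L a (k • y))
    (hAst : ∀ (k : G) (a : Y → ℚ), a ∈ A → (fun y => a (k • y)) ∈ A)
    (hAirr : ∀ W : Submodule ℚ (Y → ℚ), W ≤ A → W ≠ ⊥ →
      (∀ (k : G) (f : Y → ℚ), f ∈ W → (fun y => f (k • y)) ∈ W) → W = A)
    (hA0 : A ≠ ⊥) {J₀ : Type u} [Fintype J₀] (ι₀ : J₀ → ((Y → ℚ) →ₗ[ℚ] (E i₀ → ℚ)))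
    (hι₀eq : ∀ (j : J₀) (k : G) (a : Y → ℚ), a ∈ A → ι₀ j (fun y => a (k • y)) = fun y => ι₀ j a (k • y))
    (hind₀ : ∀ f : J₀ → (Y → ℚ), (∀ j, f j ∈ A) → ∑ j, ι₀ j (f j) = 0 → ∀ j, f j = 0)
    {b₀ : J₀ → (Y → ℚ)} (hb₀ : ∀ j, b₀ j ∈ A) (hu₀ : antiVec (Φ i₀) (1 : G) = ∑ j, ι₀ j (b₀ j)) :
    typeRank G (Φ i₀) = Module.finrank ℚ ↥(⨆ j, 𝒟.map (LinearMap.applyₗ (b₀ j))) + 1 := by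
  obtain ⟨a₀, ha₀, h0⟩ := Submodule.exists_mem_ne_zero_of_ne_bot hA0
  have key := typeRank_mul_eq_of_class h i₀ h𝒟 hAst hAirr ι₀ hι₀eq hind₀ hb₀ hu₀ ha₀ h0
  have hδ := finrank_map_applyₗ_eq_finrank_of_comm_translates hcomm h𝒟 hAst hAirr ha₀ h0
  rw [hδ] at key
  haveI : FiniteDimensional ℚ A := Submodule.finiteDimensional_of_le le_top
  have hA : 0 < Module.finrank ℚ A := Nat.pos_of_ne_zero fun h' => hA0 (Submodule.finrank_eq_zero.1 h')
  have key' : typeRank G (Φ i₀) * Module.finrank ℚ A =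
      (Module.finrank ℚ ↥(⨆ j, 𝒟.map (LinearMap.applyₗ (b₀ j))) + 1) * Module.finrank ℚ A := by
    rw [key]; ring
  exact Nat.eq_of_mul_eq_mul_right hA key'

/-- **`rank Σ = dim(⨆_i D⟨b^i⟩) + 1` FOR A COMMUTING ACTION**: `dim Hg(∏_i A_i)` is the `ℚ`-dimension of the D-span
of ALL the type components (file S4's `rank Σ·δ = δ + dim(⨆_i D⟨b^i⟩)·dim A` with `δ = dim A`).
[cite: Serre1977, §3.1] [cite: Deligne1982HodgeCycles, I Ex. 3.7 (c)] -/
theorem typeRank_sigmaType_eq_finrank_iSup_add_one_of_comm [Nonempty I]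
    (hcomm : ∀ (k k' : G) (y : Y), k • k' • y = k' • k • y)
    {ρ : G} {Φ : ∀ i, Set (E i)} (h : ∀ i, IsCMTypeWith ρ (Φ i))
    {A : Submodule ℚ (Y → ℚ)} {𝒟 : Submodule ℚ ((Y → ℚ) →ₗ[ℚ] (Y → ℚ))}
    (h𝒟 : ∀ L : (Y → ℚ) →ₗ[ℚ] (Y → ℚ), L ∈ 𝒟 ↔ (∀ a ∈ A, L a ∈ A) ∧
      ∀ (k : G) (a : Y → ℚ), a ∈ A → L (fun y => a (k • y)) = fun y => L a (k • y))
    (hAst : ∀ (k : G) (a : Y → ℚ), a ∈ A → (fun y => a (k • y)) ∈ A)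
    (hAirr : ∀ W : Submodule ℚ (Y → ℚ), W ≤ A → W ≠ ⊥ →
      (∀ (k : G) (f : Y → ℚ), f ∈ W → (fun y => f (k • y)) ∈ W) → W = A)
    (hA0 : A ≠ ⊥) {J : I → Type u} [∀ i, Fintype (J i)] (ι : ∀ i, J i → ((Y → ℚ) →ₗ[ℚ] (E i → ℚ)))
    (hιeq : ∀ i (j : J i) (k : G) (a : Y → ℚ), a ∈ A → ι i j (fun y => a (k • y)) = fun y => ι i j a (k • y))
    (hind : ∀ i (f : J i → (Y → ℚ)), (∀ j, f j ∈ A) → ∑ j, ι i j (f j) = 0 → ∀ j, f j = 0)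
    {b : ∀ i, J i → (Y → ℚ)} (hb : ∀ i j, b i j ∈ A) (hu : ∀ i, antiVec (Φ i) (1 : G) = ∑ j, ι i j (b i j)) :
    typeRank G (sigmaType Φ) = Module.finrank ℚ ↥(⨆ i, ⨆ j, 𝒟.map (LinearMap.applyₗ (b i j))) + 1 := by
  obtain ⟨a₀, ha₀, h0⟩ := Submodule.exists_mem_ne_zero_of_ne_bot hA0
  have key := typeRank_sigmaType_mul_eq_of_class h h𝒟 hAst hAirr ι hιeq hind hb hu ha₀ h0
  have hδ := finrank_map_applyₗ_eq_finrank_of_comm_translates hcomm h𝒟 hAst hAirr ha₀ h0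
  rw [hδ] at key
  haveI : FiniteDimensional ℚ A := Submodule.finiteDimensional_of_le le_top
  have hA : 0 < Module.finrank ℚ A := Nat.pos_of_ne_zero fun h' => hA0 (Submodule.finrank_eq_zero.1 h')
  have key' : typeRank G (sigmaType Φ) * Module.finrank ℚ A =
      (Module.finrank ℚ ↥(⨆ i, ⨆ j, 𝒟.map (LinearMap.applyₗ (b i j))) + 1) * Module.finrank ℚ A := by
    rw [key]; ring
  exact Nat.eq_of_mul_eq_mul_right hA key'

end Ranks

end Summit.HodgeConjecture.CorCM.IrrOdd

/-! ### CM dress -/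

namespace Summit.HodgeConjecture.CorCM

open CategoryTheory CategoryTheory.Limits NumberField Module IntermediateField
open Literature.NumberTheory.ComplexMultiplication
open Literature.AlgebraicGeometry.Motives (AbelianVariety CMType)
open Literature.AlgebraicGeometry.Motives.AbelianVariety
open Literature.AlgebraicGeometry.HodgeTheory
open Literature.AlgebraicGeometry.ComplexMultiplication (IsCMTypeRealisation)
open Literature.AlgebraicGeometry.Pohlmann1968

variable {I : Type} [Fintype I] {K : I → Type} [∀ i, Field (K i)] [∀ i, NumberField (K i)] [∀ i, IsCMField (K i)]
  {Y : Type v} [MulAction (ℂ ≃+* ℂ) Y] [Fintype Y]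

omit [Fintype I] in
/-- **`cmTypeRank Φ = dim D⟨b⟩ + 1` when `Aut(ℂ)` acts through COMMUTING permutations of the reference set `Y`**
(e.g. `Y = Hom(L, ℂ)` for an ABELIAN CM field `L`): `dim MT(A_Φ) − 1 = dim_ℚ D⟨b⟩`.
[cite: Serre1977, §3.1] [cite: Deligne1982HodgeCycles, I.3.4] -/
theorem cmTypeRank_eq_finrank_iSup_add_one_of_comm
    (hcomm : ∀ (k k' : ℂ ≃+* ℂ) (y : Y), k • k' • y = k' • k • y) (Φ : ∀ i, CMType (K i)) (i₀ : I)
    {A : Submodule ℚ (Y → ℚ)} {𝒟 : Submodule ℚ ((Y → ℚ) →ₗ[ℚ] (Y → ℚ))}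
    (h𝒟 : ∀ L : (Y → ℚ) →ₗ[ℚ] (Y → ℚ), L ∈ 𝒟 ↔ (∀ a ∈ A, L a ∈ A) ∧
      ∀ (k : ℂ ≃+* ℂ) (a : Y → ℚ), a ∈ A → L (fun y => a (k • y)) = fun y => L a (k • y))
    (hAst : ∀ (k : ℂ ≃+* ℂ) (a : Y → ℚ), a ∈ A → (fun y => a (k • y)) ∈ A)
    (hAirr : ∀ W : Submodule ℚ (Y → ℚ), W ≤ A → W ≠ ⊥ →
      (∀ (k : ℂ ≃+* ℂ) (f : Y → ℚ), f ∈ W → (fun y => f (k • y)) ∈ W) → W = A)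
    (hA0 : A ≠ ⊥) {J₀ : Type} [Fintype J₀] (ι₀ : J₀ → ((Y → ℚ) →ₗ[ℚ] ((K i₀ →+* ℂ) → ℚ)))
    (hι₀eq : ∀ (j : J₀) (k : ℂ ≃+* ℂ) (a : Y → ℚ), a ∈ A → ι₀ j (fun y => a (k • y)) = fun y => ι₀ j a (k • y))
    (hind₀ : ∀ f : J₀ → (Y → ℚ), (∀ j, f j ∈ A) → ∑ j, ι₀ j (f j) = 0 → ∀ j, f j = 0)
    {b₀ : J₀ → (Y → ℚ)} (hb₀ : ∀ j, b₀ j ∈ A) (hu₀ : antiVec (Φ i₀).1 (1 : ℂ ≃+* ℂ) = ∑ j, ι₀ j (b₀ j)) :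
    cmTypeRank (Φ i₀) = Module.finrank ℚ ↥(⨆ j, 𝒟.map (LinearMap.applyₗ (b₀ j))) + 1 := by
  haveI : ∀ i, Nonempty (K i →+* ℂ) := fun i => inferInstance
  exact IrrOdd.typeRank_eq_finrank_iSup_add_one_of_comm (G := ℂ ≃+* ℂ) (E := fun i => K i →+* ℂ) hcomm
    (Φ := fun i => (Φ i).1) (fun i => isCMTypeWith_conj (Φ i)) i₀ h𝒟 hAst hAirr hA0 ι₀ hι₀eq hind₀ hb₀ hu₀

/-- **`cmFamilyRank Φ = dim(⨆_i D⟨b^i⟩) + 1` for a COMMUTING action**: `dim MT(∏_i A_i) − 1` is the `ℚ`-dimension of the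
D-span of all the type components. [cite: Serre1977, §3.1] [cite: Deligne1982HodgeCycles, I Ex. 3.7 (c)] -/
theorem cmFamilyRank_eq_finrank_iSup_add_one_of_comm [Nonempty I]
    (hcomm : ∀ (k k' : ℂ ≃+* ℂ) (y : Y), k • k' • y = k' • k • y) (Φ : ∀ i, CMType (K i))
    {A : Submodule ℚ (Y → ℚ)} {𝒟 : Submodule ℚ ((Y → ℚ) →ₗ[ℚ] (Y → ℚ))}
    (h𝒟 : ∀ L : (Y → ℚ) →ₗ[ℚ] (Y → ℚ), L ∈ 𝒟 ↔ (∀ a ∈ A, L a ∈ A) ∧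
      ∀ (k : ℂ ≃+* ℂ) (a : Y → ℚ), a ∈ A → L (fun y => a (k • y)) = fun y => L a (k • y))
    (hAst : ∀ (k : ℂ ≃+* ℂ) (a : Y → ℚ), a ∈ A → (fun y => a (k • y)) ∈ A)
    (hAirr : ∀ W : Submodule ℚ (Y → ℚ), W ≤ A → W ≠ ⊥ →
      (∀ (k : ℂ ≃+* ℂ) (f : Y → ℚ), f ∈ W → (fun y => f (k • y)) ∈ W) → W = A)
    (hA0 : A ≠ ⊥) {J : I → Type} [∀ i, Fintype (J i)] (ι : ∀ i, J i → ((Y → ℚ) →ₗ[ℚ] ((K i →+* ℂ) → ℚ)))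
    (hιeq : ∀ i (j : J i) (k : ℂ ≃+* ℂ) (a : Y → ℚ), a ∈ A → ι i j (fun y => a (k • y)) = fun y => ι i j a (k • y))
    (hind : ∀ i (f : J i → (Y → ℚ)), (∀ j, f j ∈ A) → ∑ j, ι i j (f j) = 0 → ∀ j, f j = 0)
    {b : ∀ i, J i → (Y → ℚ)} (hb : ∀ i j, b i j ∈ A)
    (hu : ∀ i, antiVec (Φ i).1 (1 : ℂ ≃+* ℂ) = ∑ j, ι i j (b i j)) :
    CMAlgebra.cmFamilyRank Φ = Module.finrank ℚ ↥(⨆ i, ⨆ j, 𝒟.map (LinearMap.applyₗ (b i j))) + 1 := by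
  haveI : ∀ i, Nonempty (K i →+* ℂ) := fun i => inferInstance
  exact IrrOdd.typeRank_sigmaType_eq_finrank_iSup_add_one_of_comm (G := ℂ ≃+* ℂ) (E := fun i => K i →+* ℂ) hcomm
    (Φ := fun i => (Φ i).1) (fun i => isCMTypeWith_conj (Φ i)) h𝒟 hAst hAirr hA0 ι hιeq hind hb hu

end Summit.HodgeConjecture.CorCM

end
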